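import Summits.BirchSwinnertonDyer.BirchSwinnertonDyer.Theorems.PrintCFramBottomClassIndexLawFiveLeHerbrandLineCharactersDirichlet
import Summits.BirchSwinnertonDyer.Rank1Residual.X2.ResidualDevissageModules
import Summits.BirchSwinnertonDyer.BirchSwinnertonDyer.Theorems.PrintCFramBottomClassIndexLawFiveLeHerbrandLineRestriction
import HarnessLib

/-!
# Route `PrintCFram`, crux C2 `BottomClassIndexLawFiveLe` (stmt-BirchSwinnertonDyer-20372), line
# `eisenstein-resource-bdp-line` (registry v18; LEAD g10 report §2(d), the LEVEL DICTIONARY (α)): **THE RATIONAL LINE OF THE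
# CLASS OVER `Γ_ℚ` WITH BOTH CHARACTERS AND THEIR DIRICHLET AVATARS** — T1's end state (`θ_S = b∘χ_m`, `θ_Q = χ̄_p (b∘χ_m)⁻¹`,
# `ψ↑ = ψ₁↑ ∨ ψ↑ = ψ₁⁻¹↑ω↑`) over `ℚ` itself, for the line `W[𝔭]` as an `X2`-stable subgroup
# (cell `bsd-print-cfram`, width seat `bsd-line-cfram-p1-w6` g3; helper `--supports` 20372; 0 defs, 0 facts, 0 sorry)

HONEST FRAMING. Nothing about BSD is proved here and no stub of the line is closed. File 3 of the (α) consumer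
`levelPos_imp_classFactor` (LEAD g10 report §4 bullet 1). LEAD g8's T1 (`HerbrandLineCharacters.*`) states the Dirichlet
factor of the line characters over a QUADRATIC field `K` (Stub H's quantifiers, where the stable line is unique); the level
dictionary runs over `ℚ`, so the same bookkeeping is redone here for the rational line `W[𝔭]` of
`exists_sqrt_rationalLine_scalars_of_cmRamified` (which also supplies the product rule `a·d ≡ χ̄_p(σ)`), packaged as an
`X2.ResidualDevissageModules.StableSubgroup` over `Γ_ℚ` with T2's characters of `Φ.Sub` and `Φ.Quot`.

* **`exists_rationalLineData_of_hss`** — for `W/ℚ` globally minimal with CM, `p ≥ 5` CM-ramified and ANY Kriz–Li character datum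
  `(f, ψ, ω)` with `hss`: a `Γ_ℚ`-stable line `Φ ≤ W[p]` of order `p`, characters `θ_S, θ_Q` (`g • x = θ(g) • x`, `θ g = 1 ↔`
  trivial action) with `θ_S θ_Q = χ̄_p`, a level `m`, `b : (ℤ/m)ˣ → 𝔽_pˣ` with `θ_S = b∘χ_m`, `θ_Q = χ̄_p·(b∘χ_m)⁻¹`, the
  Teichmüller lift `ψ₁` of `b`, and at level `f·m·p`: `ψ↑ = ψ₁↑ ∨ ψ↑ = ψ₁⁻¹↑·ω↑` (w3 g3's uniqueness of the Eisenstein pair).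

THEOREMS ONLY; no definition, no named fact, no `sorry`. BSD is not proved by any of this; no summit statement is proved by
this seat. References: [Mazur1978] §5, Prop. 6.3 (1); [Washington1997] §5.1, Thm. 14.1; [KrizLi2019] §1.5, §7.1;
[SilvermanCSS1997] Ch. II §7; the LEAD g10 report §2(d).
-/

set_option autoImplicit false
-- `…BirchSwinnertonDyer.BirchSwinnertonDyer.Theorems…` is the problem's mandated namespace (D-0017).
set_option linter.dupNamespace false

noncomputable section

open scoped Classical Pointwise

namespace Summit.BirchSwinnertonDyer.BirchSwinnertonDyer.Theorems.PrintCFram.LevelDictionaryAlpha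

open NumberField IsDedekindDomain Field WeierstrassCurve DirichletCharacter
open Literature.NumberTheory.EllipticCurves Literature.NumberTheory.GaloisRepresentations
  Literature.NumberTheory.EllipticCurves.Rank1Residual Literature.NumberTheory.EllipticCurves.KrizLi2019
  Literature.NumberTheory.EllipticCurves.GreenbergSelmer
open Summit.BirchSwinnertonDyer.Rank1Residual

variable {p : ℕ} [hp : Fact p.Prime]

/-! ## §1 On the class over `ℚ`: the rational line, its two characters, and their Dirichlet avatars -/

section LineData

variable (W : WeierstrassCurve ℚ) [W.IsElliptic] [W.IsGloballyMinimal] (p)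

/-- **THE RATIONAL LINE OF THE CLASS WITH ITS DIRICHLET AVATARS (over `Γ_ℚ`).** For `W/ℚ` globally minimal with CM, `p ≥ 5`
CM-ramified, and ANY Kriz–Li character datum `(f, ψ, ω)` for `W` (`ω` Teichmüller, `hss`: `a_ℓ ≡ ψ(ℓ) + ψ⁻¹(ℓ)ω(ℓ)`): there
are a `Γ_ℚ`-stable line `Φ ≤ W[p]` of order `p` (the line `W[𝔭]`), the characters `θ_S` of `Φ` and `θ_Q` of `W[p]/Φ` (T2
`HerbrandLineRestriction.exists_character_of_card_prime`) with `θ_S θ_Q = χ̄_p` (`a d ≡ χ̄_p(σ)`, LEAD g8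
`HerbrandLineCharacters.exists_sqrt_rationalLine_scalars_of_cmRamified`), a level `m`, `b : (ℤ/m)ˣ → 𝔽_pˣ` with
`θ_S = b ∘ χ_m` and `θ_Q = χ̄_p · (b ∘ χ_m)⁻¹` (Kronecker–Weber + Mazur Prop. 6.3 (1),
`exists_cyclotomicFactor_traceForm_of_isRationalLine`), the Teichmüller lift `ψ₁` of `b`, and at level `f·m·p`:
**`ψ↑ = ψ₁↑` or `ψ↑ = ψ₁⁻¹↑·ω↑`** (uniqueness of the Eisenstein pair, w3 g3 `EisensteinPair.eq_or_eq_of_traceForm_congr`).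
This is T1's END STATE (`exists_dirichletCharacter_charSub_eq_or_eq_of_hss`, stated there over a quadratic field) over `ℚ`
itself. [cite: Mazur1978, §5 (p. 148) and §6 Prop. 6.3 (1) (p. 153)] [cite: Washington1997, Thm. 14.1 (Kronecker–Weber)]
[cite: KrizLi2019, §1.5 (p. 7) and §7.1 (p. 43)] -/
theorem exists_rationalLineData_of_hss (hCM : W.HasCM) (h5 : 5 ≤ p) (hram : CMRamified W p)
    {f : ℕ} [NeZero f] (ψ : DirichletCharacter ℚ_[p] f) (ω : DirichletCharacter ℚ_[p] p)
    (hω : IsTeichmullerCharacter ω)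
    (hss : ∀ ℓ : ℕ, ℓ.Prime → ¬ (ℓ ∣ p * W.conductorNorm ℤ) →
      ‖((W.LFunction ℓ : ℤ) : ℚ_[p]) - (ψ (ℓ : ZMod f) + ψ⁻¹ (ℓ : ZMod f) * ω (ℓ : ZMod p))‖ < 1) :
    ∃ (Φ : X2.ResidualDevissageModules.StableSubgroup (absoluteGaloisGroup ℚ) (W.geomTorsion (p : ℤ)))
      (θS θQ : absoluteGaloisGroup ℚ →* (ZMod p)ˣ) (m : ℕ) (_ : NeZero m) (b : (ZMod m)ˣ →* (ZMod p)ˣ)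
      (ψ₁ : DirichletCharacter ℚ_[p] m) (hf : f ∣ f * m * p) (hm : m ∣ f * m * p) (hpM : p ∣ f * m * p),
      Nat.card Φ.Sub = p ∧
      (∀ (g : absoluteGaloisGroup ℚ) (x : Φ.Sub), g • x = (((θS g : ZMod p).val : ℕ) : ℤ) • x) ∧
      (∀ g : absoluteGaloisGroup ℚ, θS g = 1 ↔ ∀ x : Φ.Sub, g • x = x) ∧
      (∀ (g : absoluteGaloisGroup ℚ) (y : Φ.Quot), g • y = (((θQ g : ZMod p).val : ℕ) : ℤ) • y) ∧
      (∀ g : absoluteGaloisGroup ℚ, θQ g = 1 ↔ ∀ y : Φ.Quot, g • y = y) ∧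
      (∀ g : absoluteGaloisGroup ℚ, θS g * θQ g = modNCyclotomicCharacter ℚ p g) ∧
      (∀ τ : absoluteGaloisGroup ℚ, θS τ = b (modNCyclotomicCharacter ℚ m τ)) ∧
      (∀ τ : absoluteGaloisGroup ℚ, θQ τ = modNCyclotomicCharacter ℚ p τ * (b (modNCyclotomicCharacter ℚ m τ))⁻¹) ∧
      (∀ u : (ZMod m)ˣ, ψ₁ (u : ZMod m) = (((Kato2004.teichmullerChar p (b u) : ℤ_[p]ˣ) : ℤ_[p]) : ℚ_[p])) ∧
      (changeLevel hf ψ = changeLevel hm ψ₁ ∨ changeLevel hf ψ = changeLevel hm ψ₁⁻¹ * changeLevel hpM ω) := by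
  have hpr : p.Prime := hp.out
  have hp2 : p ≠ 2 := by omega
  haveI : NeZero ((p : ℕ) : ℚ) := ⟨by exact_mod_cast hpr.ne_zero⟩
  -- the line `W[𝔭]` with both scalars and `a d ≡ χ̄_p(σ)`
  obtain ⟨s, Φ₀, -, hΦ₀, hscal⟩ := HerbrandLineCharacters.exists_sqrt_rationalLine_scalars_of_cmRamified W p hCM h5 hram
  let Φ : X2.ResidualDevissageModules.StableSubgroup (absoluteGaloisGroup ℚ) (W.geomTorsion (p : ℤ)) :=
    ⟨Φ₀, fun g _ hx ↦ hΦ₀.2 g _ hx⟩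
  have hcard : Nat.card Φ.Sub = p := hΦ₀.1
  have hcardQ : Nat.card Φ.Quot = p := HerbrandLineRestriction.natCard_quot_eq_of_card_sub W Φ hcard
  -- the two characters (T2)
  obtain ⟨θS, hθS, hkerS⟩ := HerbrandLineRestriction.exists_character_of_card_prime (p := p)
    (G := absoluteGaloisGroup ℚ) (A := Φ.Sub) hcard
  obtain ⟨θQ, hθQ, hkerQ⟩ := HerbrandLineRestriction.exists_character_of_card_prime (p := p)
    (G := absoluteGaloisGroup ℚ) (A := Φ.Quot) hcardQ
  -- the isogeny character `r = b ∘ χ_m` and the trace congruence (T1 over `ℚ`)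
  obtain ⟨P, r, m, hmz, b, hP0, hPgen, hr, hrb, htr⟩ :=
    HerbrandLineCharacters.exists_cyclotomicFactor_traceForm_of_isRationalLine W p hΦ₀
  -- `θS = r`
  have hPΦ : P ∈ Φ₀ := by rw [hPgen]; exact AddSubgroup.mem_zmultiples P
  set x : Φ.Sub := ⟨P, hPΦ⟩ with hx
  have hx0 : x ≠ 0 := fun h0 ↦ hP0 (congrArg Φ.incl h0)
  have hθSr : ∀ g : absoluteGaloisGroup ℚ, θS g = r g := by
    intro g
    have h1 : g • x = ((((r g : (ZMod p)ˣ) : ZMod p).val : ℕ) : ℤ) • x := by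
      apply Φ.incl_injective
      rw [Φ.incl_smul, map_zsmul, natCast_zsmul]
      exact hr g
    have h2 := HerbrandLineRestriction.intCast_eq_of_zsmul_eq (p := p) hcard hx0
      (a := (((θS g : ZMod p).val : ℕ) : ℤ)) (b := (((r g : (ZMod p)ˣ) : ZMod p).val : ℕ)) (by rw [← hθS g x, h1])
    rw [Int.cast_natCast, Int.cast_natCast, ZMod.natCast_zmod_val, ZMod.natCast_zmod_val] at h2
    exact Units.ext h2
  -- `θS θQ = χ̄_p`
  have hprod : ∀ g : absoluteGaloisGroup ℚ, θS g * θQ g = modNCyclotomicCharacter ℚ p g := by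
    intro g
    obtain ⟨a, d, hline, hquot, had, -⟩ := hscal g
    -- `θS g = a`
    have hSa : ((θS g : ZMod p) : ZMod p) = (a : ZMod p) := by
      have h1 : g • x = a • x := Φ.incl_injective (by rw [Φ.incl_smul, map_zsmul]; exact hline P hPΦ)
      have h2 := HerbrandLineRestriction.intCast_eq_of_zsmul_eq (p := p) hcard hx0
        (a := (((θS g : ZMod p).val : ℕ) : ℤ)) (b := a) (by rw [← hθS g x, h1])
      rwa [Int.cast_natCast, ZMod.natCast_zmod_val] at h2
    -- `θQ g = d`
    haveI : Finite Φ.Quot := Nat.finite_of_card_ne_zero (by rw [hcardQ]; exact hpr.ne_zero)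
    haveI : Nontrivial Φ.Quot := Finite.one_lt_card_iff_nontrivial.mp (by rw [hcardQ]; exact hpr.one_lt)
    obtain ⟨y, hy⟩ := exists_ne (0 : Φ.Quot)
    obtain ⟨Q, rfl⟩ := Φ.proj_surjective y
    have hQd : g • Φ.proj Q = d • Φ.proj Q := by
      rw [Φ.smul_proj, ← sub_eq_zero, ← map_zsmul, ← map_sub]
      have hmem : g • Q - d • Q ∈ Φ.incl.range := by
        rw [Φ.range_incl]; exact hquot Q
      obtain ⟨t, ht⟩ := hmem
      rw [← ht]; exact Φ.proj_incl t
    have hQd' : ((θQ g : ZMod p) : ZMod p) = (d : ZMod p) := by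
      have h2 := HerbrandLineRestriction.intCast_eq_of_zsmul_eq (p := p) hcardQ hy
        (a := (((θQ g : ZMod p).val : ℕ) : ℤ)) (b := d) (by rw [← hθQ g (Φ.proj Q), hQd])
      rwa [Int.cast_natCast, ZMod.natCast_zmod_val] at h2
    apply Units.ext
    rw [Units.val_mul, hSa, hQd', ← Int.cast_mul, had, modPCyclotomicCharacterZMod_eq_modNCyclotomicCharacter]
  have hSb : ∀ τ : absoluteGaloisGroup ℚ, θS τ = b (modNCyclotomicCharacter ℚ m τ) := fun τ ↦ by rw [hθSr, hrb]
  have hQb : ∀ τ : absoluteGaloisGroup ℚ,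
      θQ τ = modNCyclotomicCharacter ℚ p τ * (b (modNCyclotomicCharacter ℚ m τ))⁻¹ := fun τ ↦ by
    rw [← hSb τ, ← hprod τ, mul_inv_cancel_comm]
  -- the Teichmüller lift and the Eisenstein-pair disjunction
  obtain ⟨ψ₁, hψ₁⟩ := HerbrandLineCharacters.exists_teichmuller_dirichletCharacter p b
  haveI : NeZero (f * m * p) := ⟨Nat.mul_ne_zero (Nat.mul_ne_zero (NeZero.ne f) (NeZero.ne m)) hpr.ne_zero⟩
  have hfM : f ∣ f * m * p := dvd_mul_of_dvd_left (dvd_mul_right f m) p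
  have hmM : m ∣ f * m * p := dvd_mul_of_dvd_left (dvd_mul_left m f) p
  have hpM : p ∣ f * m * p := dvd_mul_left p (f * m)
  have hN : p * m * W.conductorNorm ℤ ≠ 0 :=
    Nat.mul_ne_zero (Nat.mul_ne_zero hpr.ne_zero (NeZero.ne m)) W.conductorNorm_pos_holds.ne'
  have e := EisensteinPair.eq_or_eq_of_traceForm_congr (p := p) hp2 hmM hfM hpM ψ₁ ψ ω hN (fun ℓ hℓ hℓN => by
    haveI : Fact ℓ.Prime := ⟨hℓ⟩
    have hℓp : ℓ ≠ p := by rintro rfl; exact hℓN (dvd_mul_of_dvd_left (dvd_mul_right ℓ m) _)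
    have hℓm : ℓ.Coprime m := (Nat.Prime.coprime_iff_not_dvd hℓ).mpr fun hd =>
      hℓN (dvd_mul_of_dvd_left (dvd_mul_of_dvd_right hd p) _)
    have hℓN' : ¬ ℓ ∣ p * W.conductorNorm ℤ := fun hd => by
      apply hℓN
      rcases (Nat.Prime.dvd_mul hℓ).mp hd with h1 | h1
      · exact dvd_mul_of_dvd_left (dvd_mul_of_dvd_left h1 m) _
      · exact dvd_mul_of_dvd_right h1 _
    have hgood : W.HasGoodReductionAtPrime ℓ := by
      by_contra hbad
      exact hℓN' (dvd_mul_of_dvd_right ((W.dvd_conductorNorm_iff_not_hasGoodReductionAtPrime ℓ).mpr hbad) _)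
    have ha : ((W.LFunction ℓ : ℤ) : ZMod p) = ((b (ZMod.unitOfCoprime ℓ hℓm) : (ZMod p)ˣ) : ZMod p) +
        (ℓ : ZMod p) * (((b (ZMod.unitOfCoprime ℓ hℓm))⁻¹ : (ZMod p)ˣ) : ZMod p) := by
      rw [LFunction_apply_prime_eq_frobeniusTrace W ℓ hgood]; exact htr ℓ hℓp hgood hℓm
    have h1 := HerbrandLineCharacters.norm_traceForm_sub_lt_one_of_congr p b hψ₁ hω hℓ hℓp hℓm ha
    have h2 := hss ℓ hℓ hℓN'
    have e : (ψ₁ (ℓ : ZMod m) + ψ₁⁻¹ (ℓ : ZMod m) * ω (ℓ : ZMod p)) - (ψ (ℓ : ZMod f) + ψ⁻¹ (ℓ : ZMod f) * ω (ℓ : ZMod p)) =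
        (((W.LFunction ℓ : ℤ) : ℚ_[p]) - (ψ (ℓ : ZMod f) + ψ⁻¹ (ℓ : ZMod f) * ω (ℓ : ZMod p))) +
          -(((W.LFunction ℓ : ℤ) : ℚ_[p]) - (ψ₁ (ℓ : ZMod m) + ψ₁⁻¹ (ℓ : ZMod m) * ω (ℓ : ZMod p))) := by ring
    rw [e]
    refine lt_of_le_of_lt (IsUltrametricDist.norm_add_le_max _ _) (max_lt h2 ?_)
    rw [norm_neg]; exact h1)
  refine ⟨Φ, θS, θQ, m, hmz, b, ψ₁, hfM, hmM, hpM, hcard, hθS, hkerS, hθQ, hkerQ, hprod, hSb, hQb, hψ₁, ?_⟩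
  rcases e with e | e
  · exact Or.inl e
  · exact Or.inr e

end LineData

end Summit.BirchSwinnertonDyer.BirchSwinnertonDyer.Theorems.PrintCFram.LevelDictionaryAlpha

end
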